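import Summits.Ventures.LatticeQCDFlow.Scoring.UNOnePlaquetteBesselDeterminant
import Literature.Barriers.QuantumFields.GrossWittenTransition
import HarnessLib

/-!
# The Gross–Witten unitary matrix integral IS the `U(N)` one-plaquette Haar integral: `G_N(γ) = ∫_{U(N)} e^{γN Re tr U} dU = det[I_{|i−j|}(Nγ)]`

HONEST FRAMING: exact (Metropolis-corrected) sampling algorithms for lattice gauge theory;
figures of merit are autocorrelation/cost numbers at stated couplings and volumes; no
continuum-physics claim.

Venture `LatticeQCDFlow` (cell pub-lqcd), sub-topic `Scoring`; FANOUT row 5 (`s0-sun-a`), GEN-17.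
NEW WORK of the cell (placement rule).  The barrier file
`Literature/Barriers/QuantumFields/GrossWittenTransition.lean` defines Johansson's finite-`n` Gross–Witten
partition function `gwPartitionFunction n γ = ((2π)ⁿ n!)⁻¹ ∫_{[−π,π]ⁿ} Π_{j<k}|e^{iθ_j} − e^{iθ_k}|² e^{γ n Σ_j cos θ_j} dθ`
(the eigenvalue density of Haar measure on `U(n)`) and SAYS in its docstring that "by Weyl's formula
`G_n(γ) = ∫_{U(n)} exp(γ n Re tr U) dU`" — Weyl's formula was not in the tree then.  It is now
(`weylIntegralFormula_unitary_holds`), and GEN-17's `UNOnePlaquetteBesselDeterminant` evaluates the `U(N)`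
one-plaquette integral; this file makes the barrier file's sentence a theorem and gives `G_N` in closed form:

* §1 the eigenvalue weight of the barrier file (`cueWeight`, a product over `j < k` in `Fin N`) is the
  Weyl weight `Π_{j≺k}|e^{iθ_j} − e^{iθ_k}|²` of the tree's Weyl files (product over `OD (Fin N)`), both being
  the order-free `Π_i Π_{j≠i} |e^{iθ_i} − e^{iθ_j}|`;
* §2 **`gwPartitionFunction N γ = det[I_{|i−j|}(γN)]_{i,j<N}`** (the box `[−π,π]^N` and the cube `(−π,π]^N`
  differ by a null set; then part 1 `BesselToeplitzAndreief`);
* §3 **`gwPartitionFunction N γ = ∫_{U(N)} e^{γN Re tr U} dU`** — Johansson's `G_N(γ)` IS theory-2's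
  normalised `U(N)` one-plaquette Haar integral at 't Hooft-scaled coupling — and Johansson's finite-`n`
  free energy is `f_N(γ) = N⁻² log det[I_{|i−j|}(γN)]` (positivity `G_N > 0` is already theory-1's
  `TrivializingMaps.GrossWittenPinching.gwPartitionFunction_pos`, proved there from the integrand; here it
  also follows from `det_besselI_toeplitz_fin_pos`).

So the barrier's `N = ∞` objects (`gwFreeEnergy`, the third-order transition at `γ = 1`) are now tied to
honest finite-`N` Haar integrals of the lattice model.  No `def`, nothing cited as a fact, 0 sorry.
-/

noncomputable section

open Real MeasureTheory Finset Complex Equiv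
open scoped ENNReal
open Literature.MathematicalPhysics.QuantumFieldTheory (haarProbability)
open Literature.Analysis.FunctionSpaces
open Literature.RepresentationTheory.CompactGroups.WeylIntegration
open Literature.Barriers.QuantumFields

namespace Summit.Ventures.LatticeQCDFlow.Scoring

/-! ### 1. The barrier file's eigenvalue weight is the Weyl weight -/

/-- **`Π_j Π_{k>j} g(j,k)² = Π_i Π_{j≠i} g(i,j)`** for a symmetric `g` on `Fin N` (each unordered pair occurs
twice off the diagonal). -/
theorem prod_prod_Ioi_sq_eq_prod_offDiag {M : Type*} [CommMonoid M] {N : ℕ} (g : Fin N → Fin N → M)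
    (hg : ∀ i j, g i j = g j i) :
    ∏ j, ∏ k ∈ Finset.Ioi j, g j k ^ 2 = ∏ i, ∏ j ∈ Finset.univ.erase i, g i j := by
  -- the off-diagonal pairs, split into `<` and `>`
  have h1 : ∏ i : Fin N, ∏ j ∈ Finset.univ.erase i, g i j =
      ∏ q ∈ (Finset.univ : Finset (Fin N × Fin N)).filter (fun q => q.1 ≠ q.2), g q.1 q.2 := by
    rw [Finset.prod_filter, Fintype.prod_prod_type]
    refine Finset.prod_congr rfl fun i _ => ?_
    rw [← Finset.filter_ne Finset.univ i, Finset.prod_filter]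
  set Dlt := (Finset.univ : Finset (Fin N × Fin N)).filter (fun q => q.1 < q.2) with hDlt
  set Dgt := (Finset.univ : Finset (Fin N × Fin N)).filter (fun q => q.2 < q.1) with hDgt
  have hsplit : (Finset.univ : Finset (Fin N × Fin N)).filter (fun q => q.1 ≠ q.2) = Dlt ∪ Dgt := by
    ext q
    simp only [Finset.mem_filter, Finset.mem_univ, true_and, Finset.mem_union, hDlt, hDgt]
    exact ⟨fun hq => lt_or_gt_of_ne hq, fun h => h.elim ne_of_lt ne_of_gt⟩
  have hdisj : Disjoint Dlt Dgt := by
    rw [hDlt, hDgt, Finset.disjoint_filter]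
    intro q _ hlt hgt
    exact lt_asymm hlt hgt
  have hgt : ∏ q ∈ Dgt, g q.1 q.2 = ∏ q ∈ Dlt, g q.1 q.2 := by
    refine Finset.prod_equiv (Equiv.prodComm (Fin N) (Fin N)) (fun q => ?_) (fun q _ => hg _ _)
    simp [hDlt, hDgt]
  have hlt : ∏ q ∈ Dlt, g q.1 q.2 = ∏ j, ∏ k ∈ Finset.Ioi j, g j k := by
    rw [hDlt, ← Finset.prod_finset_product' ((Finset.univ : Finset (Fin N × Fin N)).filter (fun q => q.1 < q.2))
      Finset.univ (fun j => Finset.Ioi j) (fun q => by simp)]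
  rw [h1, hsplit, Finset.prod_union hdisj, hgt, hlt, ← Finset.prod_mul_distrib]
  refine Finset.prod_congr rfl fun j _ => ?_
  rw [← Finset.prod_mul_distrib]
  exact Finset.prod_congr rfl fun k _ => sq _

/-- **The barrier file's eigenvalue weight is the Weyl weight**:
`cueWeight N θ = Π_{j<k}|e^{iθ_j} − e^{iθ_k}|² = Π_{p : OD (Fin N)} |e^{iθ_{p₁}} − e^{iθ_{p₂}}|²`. -/
theorem cueWeight_eq_prod_OD (N : ℕ) (θ : Fin N → ℝ) :
    cueWeight N θ = ∏ p : OD (Fin N), ‖cexp (θ p.1.1 * I) - cexp (θ p.1.2 * I)‖ ^ 2 := by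
  rw [cueWeight, prod_prod_Ioi_sq_eq_prod_offDiag (fun j k => ‖cexp (θ j * I) - cexp (θ k * I)‖)
    (fun i j => norm_sub_rev _ _), prod_offDiag_eq_prod_OD]
  exact Finset.prod_congr rfl fun p _ => by rw [norm_sub_rev (cexp (θ p.1.2 * I)), sq]

/-! ### 2. `G_N(γ) = det[I_{|i−j|}(γN)]` -/

/-- **JOHANSSON'S `G_N(γ)` IN CLOSED FORM**: `gwPartitionFunction N γ = det[I_{|i−j|}(γN)]_{i,j<N}`
(the Gross–Witten / Bars–Green Toeplitz determinant at `x = γN`). -/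
theorem gwPartitionFunction_eq_det (N : ℕ) (γ : ℝ) :
    gwPartitionFunction N γ = (Matrix.of fun i j : Fin N => besselI ((i : ℤ) - (j : ℤ)).natAbs (γ * N)).det := by
  unfold gwPartitionFunction eigenBox
  -- the closed box and the half-open cube differ by a null set
  rw [setIntegral_congr_set (show (Set.pi Set.univ fun _ : Fin N => Set.Icc (-π) π) =ᵐ[volume]
      (Set.pi Set.univ fun _ : Fin N => Set.Ioc (-π) π) by
        rw [volume_pi]
        exact (Measure.pi_Ioc_ae_eq_pi_Icc (μ := fun _ : Fin N => (volume : Measure ℝ))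
          (s := Set.univ) (f := fun _ => -π) (g := fun _ => π)).symm),
    show (volume : Measure (Fin N → ℝ)).restrict (Set.pi Set.univ fun _ => Set.Ioc (-π) π) =
      Measure.pi fun _ : Fin N => (volume : Measure ℝ).restrict (Set.Ioc (-π) π) from Measure.restrict_pi_pi _ _]
  have hfun : ∀ θ : Fin N → ℝ, cueWeight N θ * Real.exp (γ * N * ∑ j, Real.cos (θ j))
      = Real.exp ((γ * N) * ∑ j, Real.cos (θ j)) * ∏ p : OD (Fin N), ‖cexp (θ p.1.1 * I) - cexp (θ p.1.2 * I)‖ ^ 2 := by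
    intro θ
    rw [cueWeight_eq_prod_OD, mul_comm]
  simp_rw [hfun]
  rw [integral_cube_exp_mul_sum_cos_mul_prod_norm_sub_sq, det_besselI_toeplitz_enum_eq, det_besselI_toeplitz_fin_card,
    Fintype.card_fin, ← mul_assoc, inv_mul_cancel₀ (by positivity), one_mul]

/-! ### 3. `G_N(γ)` is the `U(N)` one-plaquette Haar integral -/

/-- **THE BARRIER FILE'S SENTENCE AS A THEOREM**: "by Weyl's formula `G_n(γ) = ∫_{U(n)} exp(γ n Re tr U) dU`
(normalised Haar measure)" — `gwPartitionFunction N γ = ∫_{U(N)} e^{γN Re tr U} dU`. -/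
theorem gwPartitionFunction_eq_integral_haar (N : ℕ) (γ : ℝ) :
    gwPartitionFunction N γ
      = ∫ u, Real.exp (γ * N * ((u : Matrix.unitaryGroup (Fin N) ℂ) : Matrix (Fin N) (Fin N) ℂ).trace.re)
          ∂(haarProbability (Matrix.unitaryGroup (Fin N) ℂ)) := by
  rw [gwPartitionFunction_eq_det, integral_haar_unitaryGroup_fin_exp_mul_trace_re]

/-- **Johansson's finite-`n` free energy in closed form**: `f_N(γ) = N⁻² log det[I_{|i−j|}(γN)]_{i,j<N}`. -/
theorem gwFreeEnergyN_eq_log_det (N : ℕ) (γ : ℝ) :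
    gwFreeEnergyN N γ
      = Real.log ((Matrix.of fun i j : Fin N => besselI ((i : ℤ) - (j : ℤ)).natAbs (γ * N)).det) / (N : ℝ) ^ 2 := by
  rw [gwFreeEnergyN, gwPartitionFunction_eq_det]

/-- `N = 1`: `G₁(γ) = I₀(γ)` (consistent with the barrier file's `gwPartitionFunction_one`,
`(2π)⁻¹ ∫_{−π}^{π} e^{γ cos θ} dθ`). -/
theorem gwPartitionFunction_one_eq_besselI (γ : ℝ) : gwPartitionFunction 1 γ = besselI 0 γ := by
  rw [gwPartitionFunction_eq_det, Matrix.det_unique]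
  simp

/-- `N = 2`: `G₂(γ) = I₀(2γ)² − I₁(2γ)²`. -/
theorem gwPartitionFunction_two_eq (γ : ℝ) :
    gwPartitionFunction 2 γ = besselI 0 (2 * γ) ^ 2 - besselI 1 (2 * γ) ^ 2 := by
  rw [gwPartitionFunction_eq_det, Matrix.det_fin_two]
  simp [Matrix.of_apply, mul_comm γ 2]
  ring

end Summit.Ventures.LatticeQCDFlow.Scoring
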